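import Literature.MathematicalPhysics.QuantumLattice.GrassmannCumulantKernelBound
import HarnessLib

/-!
# `‖𝓔ᵀ_C(V; n)‖ ≤ n! Cⁿ ‖V‖ⁿ`: the single-scale bound with explicit per-field constants

Topic `Literature/MathematicalPhysics/QuantumLattice`; the bound of `GrassmannCumulantKernelBound.lean`
(`sum_norm_kernel_cumulantOf_le`, any positive `λ_δ` per degree assignment `δ`) made turnkey by the choices and
elementary inequalities of the renormalisation-group literature (Benfatto–Giuliani–Mastropietro 2006, (2.77)–(2.80);
Gawȩdzki–Kupiainen 1985, §3; Gentile–Mastropietro 2001, §4):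

* `prod_sym2_le_prod_prod`, `prod_one_add_mul_pairDeg_le_exp` — `∏_ℓ (1 + c (d d')_ℓ) ≤ exp (c (Σ d)²)`;
* `treeFactor_choice_le` (via `Real.pow_div_factorial_le_exp`) — with `λ_δ = 1/(α (N_δ + n))`, `λ_δ^{-(n-1)} ∏_ℓ (1 + λ_δ α (2δ)(2δ')_ℓ) ≤ (n-1)! α^{n-1} e^{2N_δ + n}`;
* `choose_mul_pow_le` — `[r + 2(n-1) ≤ N] (r!)⁻¹ N^{(r)} κ^{N-r-2(n-1)} ≤ ρ^{-r} κ^{-2(n-1)} (κ+ρ)^N` (one binomial term);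
* `sum_piFinset_prod_eq_pow` — `Σ_δ ∏_a F(δ_a) = (Σ_{m'} F m')ⁿ`;
* **`sum_norm_kernel_cumulantOf_le_pow`** — one output label pinned, the others summed:
  `Σ_{W : W_i = w} ‖kernel_r 𝓔ᵀ_C(V; n) (W)‖ ≤ n! · ρ^{-r} κ^{-2(n-1)} α^{n-1} eⁿ · ‖V‖_hⁿ`,
  `‖V‖_h = Σ_{m'} (e²(κ+ρ))^{2m'} N_{m'}` (field weight `h = e²(κ + ρ)`: every field of `V` is either an output
  leg, `ρ`, or contracted, `κ`; `e²` absorbs the tree combinatorics).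

Everything is proved; no named fact.

## Sources

G. Benfatto, A. Giuliani, V. Mastropietro, Ann. Henri Poincaré 7 (2006) 809–898, (2.77)–(2.80)
(`BenfattoGiulianiMastropietro2006`); K. Gawȩdzki, A. Kupiainen, Comm. Math. Phys. 102 (1985) 1–30, §3
(`GawedzkiKupiainen1985GrossNeveu`); G. Gentile, V. Mastropietro, Phys. Rep. 352 (2001) 273–437, §4
(`GentileMastropietro2001`).
-/

noncomputable section

namespace Literature.MathematicalPhysics.QuantumLattice

open GrassmannAlgebra Finset Literature.Probability.LatticeModels
open scoped InnerProductSpace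

/-! ### Elementary inequalities -/

section Elementary

/-- A product of factors `≥ 1` over unordered pairs is at most the product over ordered pairs. [folklore] -/
theorem prod_sym2_le_prod_prod {ι : Type*} [Fintype ι] [DecidableEq ι] (f : Sym2 ι → ℝ) (hf : ∀ ℓ, 1 ≤ f ℓ) :
    ∏ ℓ : Sym2 ι, f ℓ ≤ ∏ p : ι × ι, f s(p.1, p.2) := by
  rw [← prod_fiberwise univ (fun p : ι × ι => s(p.1, p.2)) fun p => f s(p.1, p.2)]
  refine prod_le_prod (fun ℓ _ => zero_le_one.trans (hf ℓ)) fun ℓ _ => ?_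
  rw [prod_congr rfl fun p hp => by rw [(mem_filter.1 hp).2], prod_const]
  refine le_self_pow₀ (hf ℓ) (card_pos.2 ?_).ne'
  induction ℓ using Sym2.ind with
  | h a b => exact ⟨(a, b), mem_filter.2 ⟨mem_univ _, rfl⟩⟩

/-- **`∏_ℓ (1 + c (d d')_ℓ) ≤ exp (c (Σ_a d_a)²)`** for `c ≥ 0`. [folklore] -/
theorem prod_one_add_mul_pairDeg_le_exp {n : ℕ} (d : Fin n → ℕ) {c : ℝ} (hc : 0 ≤ c) :
    ∏ ℓ : Sym2 (Fin n), (1 + c * (pairDeg d ℓ : ℝ)) ≤ Real.exp (c * (∑ a, (d a : ℝ)) ^ 2) := by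
  calc ∏ ℓ : Sym2 (Fin n), (1 + c * (pairDeg d ℓ : ℝ))
      ≤ ∏ p : Fin n × Fin n, (1 + c * (pairDeg d s(p.1, p.2) : ℝ)) :=
        prod_sym2_le_prod_prod _ fun ℓ => le_add_of_nonneg_right (by positivity)
    _ ≤ ∏ p : Fin n × Fin n, Real.exp (c * (pairDeg d s(p.1, p.2) : ℝ)) :=
        prod_le_prod (fun p _ => by positivity) fun p _ => by rw [add_comm]; exact Real.add_one_le_exp _
    _ = Real.exp (∑ p : Fin n × Fin n, c * (pairDeg d s(p.1, p.2) : ℝ)) := (Real.exp_sum _ _).symm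
    _ = Real.exp (c * (∑ a, (d a : ℝ)) ^ 2) := by
        congr 1
        rw [← mul_sum, Fintype.sum_prod_type, sq, sum_mul_sum]
        congr 1
        refine sum_congr rfl fun a _ => sum_congr rfl fun b _ => ?_
        simp [pairDeg, Sym2.lift_mk]

/-- **The tree factor with `λ_δ = 1/(α (N_δ + n))`**: `λ^{-(n-1)} ∏_ℓ (1 + λ α (2δ)(2δ')_ℓ) ≤ (n-1)! α^{n-1} e^{2N_δ + n}`
(`N_δ = Σ_a 2δ_a`). [folklore] -/
theorem treeFactor_choice_le {n : ℕ} (hn : 0 < n) (δ : Fin n → ℕ) {α : ℝ} (hα : 0 < α) :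
    ((α * ((∑ a, (2 * δ a : ℝ)) + n))⁻¹)⁻¹ ^ (n - 1) *
        ∏ ℓ : Sym2 (Fin n), (1 + (α * ((∑ a, (2 * δ a : ℝ)) + n))⁻¹ * (α * (pairDeg (fun a => 2 * δ a) ℓ : ℝ))) ≤
      ((n - 1).factorial : ℝ) * α ^ (n - 1) * Real.exp (2 * (∑ a, (2 * δ a : ℝ)) + n) := by
  set Nδ : ℝ := ∑ a, (2 * δ a : ℝ) with hNδ
  have hN0 : 0 ≤ Nδ := sum_nonneg fun a _ => by positivity
  have hNn : 0 < Nδ + n := add_pos_of_nonneg_of_pos hN0 (by exact_mod_cast hn)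
  have h1 : ((α * (Nδ + n))⁻¹)⁻¹ ^ (n - 1) ≤ ((n - 1).factorial : ℝ) * α ^ (n - 1) * Real.exp (Nδ + n) := by
    rw [inv_inv, mul_pow]
    -- `x^k ≤ k! eˣ` (`Real.pow_div_factorial_le_exp`; also `Iwaniec1980b.pow_le_factorial_mul_exp` in the sieve library)
    have hpow : (Nδ + n) ^ (n - 1) ≤ ((n - 1).factorial : ℝ) * Real.exp (Nδ + n) := by
      have h := Real.pow_div_factorial_le_exp (Nδ + n) hNn.le (n - 1)
      rwa [div_le_iff₀ (by positivity), mul_comm] at h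
    calc α ^ (n - 1) * (Nδ + n) ^ (n - 1) ≤ α ^ (n - 1) * (((n - 1).factorial : ℝ) * Real.exp (Nδ + n)) :=
          mul_le_mul_of_nonneg_left hpow (by positivity)
      _ = ((n - 1).factorial : ℝ) * α ^ (n - 1) * Real.exp (Nδ + n) := by ring
  have h2 : ∏ ℓ : Sym2 (Fin n), (1 + (α * (Nδ + n))⁻¹ * (α * (pairDeg (fun a => 2 * δ a) ℓ : ℝ))) ≤ Real.exp Nδ := by
    have hc : 0 ≤ (Nδ + n)⁻¹ := by positivity
    have hrw : ∀ ℓ : Sym2 (Fin n), (α * (Nδ + n))⁻¹ * (α * (pairDeg (fun a => 2 * δ a) ℓ : ℝ)) = (Nδ + n)⁻¹ * (pairDeg (fun a => 2 * δ a) ℓ : ℝ) := by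
      intro ℓ
      field_simp
    simp only [hrw]
    refine (prod_one_add_mul_pairDeg_le_exp (fun a => 2 * δ a) hc).trans (Real.exp_le_exp.2 ?_)
    have hsum : (∑ a, ((2 * δ a : ℕ) : ℝ)) = Nδ := by rw [hNδ]; push_cast; rfl
    rw [hsum, inv_mul_le_iff₀ hNn, sq]
    nlinarith [hN0, (show (0 : ℝ) ≤ n from Nat.cast_nonneg n)]
  calc ((α * (Nδ + n))⁻¹)⁻¹ ^ (n - 1) * ∏ ℓ : Sym2 (Fin n), (1 + (α * (Nδ + n))⁻¹ * (α * (pairDeg (fun a => 2 * δ a) ℓ : ℝ)))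
      ≤ (((n - 1).factorial : ℝ) * α ^ (n - 1) * Real.exp (Nδ + n)) * Real.exp Nδ :=
        mul_le_mul h1 h2 (prod_nonneg fun ℓ _ => by positivity) (by positivity)
    _ = ((n - 1).factorial : ℝ) * α ^ (n - 1) * Real.exp (2 * Nδ + n) := by
        rw [show Real.exp (2 * Nδ + n) = Real.exp (Nδ + n) * Real.exp Nδ by rw [← Real.exp_add]; congr 1; ring]
        ring

/-- **One binomial term**: for `r + 2(n-1) ≤ N`, `(r!)⁻¹ N^{(r)} κ^{N-r-2(n-1)} ≤ ρ^{-r} κ^{-2(n-1)} (κ+ρ)^N`. [folklore] -/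
theorem choose_mul_pow_le {N r m : ℕ} (h : r + m ≤ N) {κ ρ : ℝ} (hκ : 0 < κ) (hρ : 0 < ρ) :
    ((r.factorial : ℝ))⁻¹ * (N.descFactorial r : ℝ) * κ ^ (N - (r + m)) ≤ ρ⁻¹ ^ r * κ⁻¹ ^ m * (κ + ρ) ^ N := by
  have hchoose : ((r.factorial : ℝ))⁻¹ * (N.descFactorial r : ℝ) = (N.choose r : ℝ) := by
    rw [Nat.descFactorial_eq_factorial_mul_choose, Nat.cast_mul, inv_mul_cancel_left₀ (by positivity)]
  rw [hchoose]
  -- the term `m = N - r` of the binomial expansion of `(κ + ρ)^N`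
  have hterm : (N.choose r : ℝ) * (κ ^ (N - r) * ρ ^ r) ≤ (κ + ρ) ^ N := by
    rw [add_pow]
    have hr : r ≤ N := le_trans (Nat.le_add_right _ _) h
    refine (le_of_eq ?_).trans (single_le_sum (f := fun k => κ ^ k * ρ ^ (N - k) * (N.choose k : ℝ)) (fun k _ => by positivity)
      (mem_range.2 (Nat.lt_succ_of_le (Nat.sub_le N r))))
    rw [Nat.sub_sub_self hr, Nat.choose_symm hr]
    ring
  have hsplit : κ ^ (N - r) = κ ^ (N - (r + m)) * κ ^ m := by
    rw [← pow_add]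
    congr 1
    omega
  rw [hsplit] at hterm
  have hρr : 0 < ρ ^ r := by positivity
  have hκm : 0 < κ ^ m := by positivity
  rw [inv_pow, inv_pow, show (N.choose r : ℝ) * κ ^ (N - (r + m)) = ((N.choose r : ℝ) * (κ ^ (N - (r + m)) * κ ^ m * ρ ^ r)) * ((ρ ^ r)⁻¹ * (κ ^ m)⁻¹) by
    field_simp]
  calc (N.choose r : ℝ) * (κ ^ (N - (r + m)) * κ ^ m * ρ ^ r) * ((ρ ^ r)⁻¹ * (κ ^ m)⁻¹)
      ≤ (κ + ρ) ^ N * ((ρ ^ r)⁻¹ * (κ ^ m)⁻¹) := mul_le_mul_of_nonneg_right hterm (by positivity)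
    _ = (ρ ^ r)⁻¹ * (κ ^ m)⁻¹ * (κ + ρ) ^ N := by ring

/-- **The degree sums factorise**: `Σ_{δ : Fin n → degs} ∏_a F(δ_a) = (Σ_{m' ∈ degs} F m')ⁿ`. [folklore] -/
theorem sum_piFinset_prod_eq_pow {n : ℕ} (degs : Finset ℕ) (F : ℕ → ℝ) :
    ∑ δ ∈ Fintype.piFinset (fun _ : Fin n => degs), ∏ a, F (δ a) = (∑ m' ∈ degs, F m') ^ n := by
  rw [← prod_univ_sum (fun _ : Fin n => degs) fun _ m' => F m', prod_const, card_univ, Fintype.card_fin]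

end Elementary



/-! ### The bound with explicit constants -/

section Main

variable {𝕜 : Type*} [RCLike 𝕜] {Γ : Type*} [Fintype Γ] [DecidableEq Γ] {n : ℕ} (C : Matrix Γ Γ 𝕜)

/-- **`‖𝓔ᵀ_C(V; n)‖ ≤ n! Cⁿ ‖V‖_hⁿ` with explicit constants** (Benfatto–Giuliani–Mastropietro 2006, (2.77)–(2.80);
Gawȩdzki–Kupiainen 1985): for `V = Σ_{m' ∈ degs} Σ_Y K_{m'}(Y) ψ(Y)` (degrees `2m'`, anchored `L¹` norms `≤ N(m')`),
a charged covariance in Gram form on the mixed pairs with constant `κ > 0` and one-copy row and column sums of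
`‖C‖` at most `α > 0`, and an output field weight `ρ > 0`: one output label pinned and the others summed,
`Σ_{W : W_i = w} ‖kernel_r 𝓔ᵀ_C(V; n) (W)‖ ≤ n! · ρ^{-r} κ^{-2(n-1)} α^{n-1} eⁿ · (Σ_{m'} (e²(κ+ρ))^{2m'} N(m'))ⁿ`.
[cite: BenfattoGiulianiMastropietro2006, (2.77)-(2.80)] -/
theorem sum_norm_kernel_cumulantOf_le_pow {E : Type*} [NormedAddCommGroup E] [InnerProductSpace 𝕜 E]
    (q : Γ → Bool) (hC : ∀ X Y, q X = q Y → C X Y = 0) (f g : Γ → E) {κ : ℝ} (hκ : 0 < κ)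
    (hf : ∀ X, q X = true → ‖f X‖ ≤ κ) (hg : ∀ Y, q Y = false → ‖g Y‖ ≤ κ)
    (hG : ∀ X Y, q X = true → q Y = false → contr 𝕜 C X Y = ⟪f X, g Y⟫_𝕜)
    (degs : Finset ℕ) (K : (m' : ℕ) → (Fin (2 * m') → Γ) → 𝕜) (N : ℕ → ℝ) (hN0 : ∀ m', 0 ≤ N m')
    (hN : ∀ m' (j : Fin (2 * m')) (w : Γ), ∑ Y ∈ univ.filter (fun Y : Fin (2 * m') → Γ => Y j = w), ‖K m' Y‖ ≤ N m')
    {α : ℝ} (hα : 0 < α) (hrow : ∀ X, ∑ Y, ‖C X Y‖ ≤ α) (hcol : ∀ Y, ∑ X, ‖C X Y‖ ≤ α) {ρ : ℝ} (hρ : 0 < ρ)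
    (hn : 0 < n) {r : ℕ} (i : Fin r) (w : Γ) :
    ∑ W ∈ univ.filter (fun W : Fin r → Γ => W i = w),
        ‖kernel 𝕜 ((cumulantOf (fun k => evenGaussConv 𝕜 C (vertexOf 𝕜 degs K ^ k)) n : evenPart 𝕜 Γ) : GrassmannAlgebra 𝕜 Γ) r W‖ ≤
      (n.factorial : ℝ) * (ρ⁻¹ ^ r * κ⁻¹ ^ (2 * (n - 1)) * (α ^ (n - 1) * Real.exp n)) *
        (∑ m' ∈ degs, (Real.exp 2 * (κ + ρ)) ^ (2 * m') * N m') ^ n := by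
  have h := sum_norm_kernel_cumulantOf_le C q hC f g hκ.le hf hg hG degs K N hN0 hN hα.le hrow hcol
    (fun δ => (α * ((∑ a, (2 * δ a : ℝ)) + n))⁻¹) (fun δ => by positivity) hn i w
  refine h.trans ?_
  set c : ℝ := ρ⁻¹ ^ r * κ⁻¹ ^ (2 * (n - 1)) * (((n - 1).factorial : ℝ) * α ^ (n - 1) * Real.exp n) with hc
  -- every degree assignment
  have hterm : ∀ δ : Fin n → ℕ,
      (if r + 2 * (n - 1) ≤ ∑ a, 2 * δ a then cumulantBound n κ α ((α * ((∑ a, (2 * δ a : ℝ)) + n))⁻¹) N r δ else 0) ≤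
        c * ∏ a, (Real.exp 2 * (κ + ρ)) ^ (2 * δ a) * N (δ a) := by
    intro δ
    have hP : 0 ≤ ∏ a, (Real.exp 2 * (κ + ρ)) ^ (2 * δ a) * N (δ a) := prod_nonneg fun a _ => mul_nonneg (by positivity) (hN0 _)
    split_ifs with hle
    · rw [cumulantBound]
      have hA := choose_mul_pow_le (N := ∑ a, 2 * δ a) (r := r) (m := 2 * (n - 1)) hle hκ hρ
      have hT := treeFactor_choice_le hn δ hα
      have hNprod : 0 ≤ ∏ a, N (δ a) := prod_nonneg fun a _ => hN0 _
      have hTnonneg : 0 ≤ ((α * ((∑ a, (2 * δ a : ℝ)) + n))⁻¹)⁻¹ ^ (n - 1) *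
          ∏ ℓ : Sym2 (Fin n), (1 + (α * ((∑ a, (2 * δ a : ℝ)) + n))⁻¹ * (α * (pairDeg (fun a => 2 * δ a) ℓ : ℝ))) := by
        have hs : 0 ≤ ∑ a, (2 * δ a : ℝ) := sum_nonneg fun a _ => by positivity
        exact mul_nonneg (by positivity) (prod_nonneg fun ℓ _ => by positivity)
      calc ((((r.factorial : ℝ))⁻¹ * ((∑ a, 2 * δ a).descFactorial r : ℝ)) * κ ^ ((∑ a, 2 * δ a) - (r + 2 * (n - 1))) * ∏ a, N (δ a)) *
            (((α * ((∑ a, (2 * δ a : ℝ)) + n))⁻¹)⁻¹ ^ (n - 1) *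
              ∏ ℓ : Sym2 (Fin n), (1 + (α * ((∑ a, (2 * δ a : ℝ)) + n))⁻¹ * (α * (pairDeg (fun a => 2 * δ a) ℓ : ℝ))))
          ≤ ((ρ⁻¹ ^ r * κ⁻¹ ^ (2 * (n - 1)) * (κ + ρ) ^ (∑ a, 2 * δ a)) * ∏ a, N (δ a)) *
              (((n - 1).factorial : ℝ) * α ^ (n - 1) * Real.exp (2 * (∑ a, (2 * δ a : ℝ)) + n)) :=
            mul_le_mul (mul_le_mul_of_nonneg_right hA hNprod) hT hTnonneg (by positivity)
        _ = c * ∏ a, (Real.exp 2 * (κ + ρ)) ^ (2 * δ a) * N (δ a) := by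
            have hexp : Real.exp (2 * (∑ a, (2 * δ a : ℝ)) + n) = Real.exp n * ∏ a, Real.exp 2 ^ (2 * δ a) := by
              rw [Real.exp_add, mul_comm, mul_sum, Real.exp_sum]
              congr 1
              refine prod_congr rfl fun a _ => ?_
              rw [← Real.exp_nat_mul]
              congr 1
              push_cast
              ring
            rw [hexp, ← prod_pow_eq_pow_sum, hc]
            simp only [mul_pow, prod_mul_distrib]
            ring
    · exact mul_nonneg (by positivity) hP
  -- sum over the degree assignments
  calc (n : ℝ) * ∑ δ ∈ Fintype.piFinset (fun _ : Fin n => degs),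
          (if r + 2 * (n - 1) ≤ ∑ a, 2 * δ a then cumulantBound n κ α ((α * ((∑ a, (2 * δ a : ℝ)) + n))⁻¹) N r δ else 0)
      ≤ (n : ℝ) * ∑ δ ∈ Fintype.piFinset (fun _ : Fin n => degs), c * ∏ a, (Real.exp 2 * (κ + ρ)) ^ (2 * δ a) * N (δ a) :=
        mul_le_mul_of_nonneg_left (sum_le_sum fun δ _ => hterm δ) (Nat.cast_nonneg n)
    _ = (n.factorial : ℝ) * (ρ⁻¹ ^ r * κ⁻¹ ^ (2 * (n - 1)) * (α ^ (n - 1) * Real.exp n)) *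
          (∑ m' ∈ degs, (Real.exp 2 * (κ + ρ)) ^ (2 * m') * N m') ^ n := by
        rw [← mul_sum, sum_piFinset_prod_eq_pow degs fun m' => (Real.exp 2 * (κ + ρ)) ^ (2 * m') * N m', hc,
          ← Nat.mul_factorial_pred (Nat.pos_iff_ne_zero.1 hn), Nat.cast_mul]
        ring

end Main

end Literature.MathematicalPhysics.QuantumLattice
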